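import Mathlib
import Literature.Analysis.FluidPDE.Superhelicity
import HarnessLib

/-!
# Period moment laws of the rescaled Euler–Leray system, II: the FORCED viscous helicity balance
  (tools for item stmt-NavierStokesRegularity-1419, `EulerMelnikovDss.PeriodMomentLaws`, law (iv))

The tree's `IsClassicalNSSolutionOn.hasDerivWithinAt_helicity` (`Superhelicity.lean`, Frisch 1995
(2.24)/(2.29)) is the UNFORCED balance `dH/dt = −2ν S(u)`. The item's rescaled system carries the
similarity drift as a body force, so this file proves the forced twin, verbatim along the tree's
proof (differentiation under the integral sign in the uniformly rapidly decaying class, `∂ₜ curl =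
curl ∂ₜ`, self-adjointness of the curl, Lamb form, Lemma 1.5 for the two gradient pairings):

* `integral_inner_timeDerivWithin_curl_eq_forced` — at fixed time,
  `∫ ⟪∂ₜu, ω⟫ = −ν S(u) + ∫ ⟪f, ω⟫` for a force slice that is continuous and bounded;
* `hasDerivWithinAt_helicity_forced` — **`dH/dt = −2ν S(u) + 2 ∫ ⟪f, ω⟫`** within a convex time
  set, for force slices that are continuous and bounded (Moffatt 1969: helicity is injected by the
  solenoidal part of the force through `2∫⟪f, ω⟫`).

HONEST FRAMING: calculus identities about HYPOTHETICAL smooth rapidly decaying solutions; nothing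
here bears on NS regularity.
-/

noncomputable section

set_option linter.dupNamespace false

namespace Summit.NavierStokesRegularity.NavierStokesRegularity.Theorems

namespace PeriodMomentLaws

open MeasureTheory Set Function Filter Topology InnerProductSpace Literature.Analysis.FluidPDE
open scoped RealInnerProductSpace NNReal ENNReal ContDiff Laplacian

variable {S : Set ℝ} {ν : ℝ} {f u : ℝ → EuclideanSpace ℝ (Fin 3) → EuclideanSpace ℝ (Fin 3)}
  {p : ℝ → EuclideanSpace ℝ (Fin 3) → ℝ}

set_option maxHeartbeats 400000 in
/-- **`∫ ⟪∂ₜu, curl u⟫ = −ν S(u) + ∫ ⟪f, curl u⟫` for a decaying classical FORCED Navier–Stokes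
solution** (fixed-time content of the forced helicity balance): on a time set `S` of unique
differentiability, for a classical solution with viscosity `ν`, force `f` and uniformly rapidly
decaying velocity, at a time `t ∈ S` whose force slice is continuous and bounded,
`∫ ⟪∂ₜu(t), ω(t)⟫ = −ν ∫ ⟪ω(t), curl ω(t)⟫ + ∫ ⟪f(t), ω(t)⟫`. Proof as in the tree's unforced
`IsClassicalNSSolutionOn.integral_inner_timeDerivWithin_curl_eq`:
`∂ₜu = −ν curl ω − ω × u − ∇(p + ½|u|²) + f`, `⟪ω × u, ω⟫ = 0`, both gradient pairings vanish.
[cite: FrischTurbulence1995, §2.3 eqs. (2.21), (2.24), (2.27)] [cite: Moffatt1969, §3 (helicity balance with forcing)] -/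
theorem integral_inner_timeDerivWithin_curl_eq_forced
    (h : IsClassicalNSSolutionOn S ν f u p) (hU : UniqueDiffOn ℝ S)
    (hu : HasUniformRapidDecayOn S u) {t : ℝ} (ht : t ∈ S)
    (hfc : Continuous (f t)) {B : ℝ} (hfb : ∀ x, ‖f t x‖ ≤ B) :
    ∫ x, ⟪timeDerivWithin S u t x, curl (u t) x⟫ =
      -(ν * superhelicity (u t)) + ∫ x, ⟪f t x, curl (u t) x⟫ := by
  have hsm := h.smooth_velocity
  -- decay exponent `5 > dim + 1 = 4` and constants
  have hr : (Module.finrank ℝ (EuclideanSpace ℝ (Fin 3)) : ℝ) + 1 < ((5 : ℕ) : ℝ) := by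
    rw [finrank_euclideanSpace_fin]; norm_num
  have hr3 : (Module.finrank ℝ (EuclideanSpace ℝ (Fin 3)) : ℝ) < ((5 : ℕ) : ℝ) := by linarith
  have hK0 : (0 : ℝ) ≤ ((5 : ℕ) : ℝ) := by norm_num
  obtain ⟨A0, hA0, hA0b⟩ := hu.norm_le_rpow 5
  obtain ⟨A1, hA1, hA1b⟩ := hu.norm_fderiv_le_rpow hsm hU 5
  obtain ⟨A2, hA2, hA2b⟩ := hu.norm_fderiv_fderiv_le_rpow hsm hU 5
  obtain ⟨A3, hA3, hA3b⟩ := hu.norm_timeDerivWithin_le_rpow hsm hU 5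
  set C : ℝ := A0 + A1 + A2 + A3 with hC_def
  have hC : 0 ≤ C := by rw [hC_def]; positivity
  have hB : 0 ≤ B := (norm_nonneg _).trans (hfb 0)
  have h0 : ∀ x, ‖u t x‖ ≤ C * (1 + ‖x‖) ^ (-((5 : ℕ) : ℝ)) := fun x =>
    le_decay_of_le_decay x (hA0b t ht x) (by rw [hC_def]; linarith)
  have h1 : ∀ x, ‖fderiv ℝ (u t) x‖ ≤ C * (1 + ‖x‖) ^ (-((5 : ℕ) : ℝ)) := fun x =>
    le_decay_of_le_decay x (hA1b t ht x) (by rw [hC_def]; linarith)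
  have h2 : ∀ x, ‖fderiv ℝ (fderiv ℝ (u t)) x‖ ≤ C * (1 + ‖x‖) ^ (-((5 : ℕ) : ℝ)) := fun x =>
    le_decay_of_le_decay x (hA2b t ht x) (by rw [hC_def]; linarith)
  have h3 : ∀ x, ‖timeDerivWithin S u t x‖ ≤ C * (1 + ‖x‖) ^ (-((5 : ℕ) : ℝ)) :=
    fun x => le_decay_of_le_decay x (hA3b t ht x) (by rw [hC_def]; linarith)
  have hw1 (x : EuclideanSpace ℝ (Fin 3)) : (1 + ‖x‖) ^ (-((5 : ℕ) : ℝ)) ≤ (1 : ℝ) :=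
    rpow_neg_le_one x hK0
  -- regularity of the slices
  have hv2 : ContDiff ℝ 2 (u t) := contDiff_infty.1 (h.contDiff_velocity ht) 2
  have hv1 : ContDiff ℝ 1 (u t) := contDiff_infty.1 (h.contDiff_velocity ht) 1
  have hq : ContDiff ℝ ∞ (p t) := h.contDiff_pressure ht
  have hq1 : ContDiff ℝ 1 (p t) := contDiff_infty.1 hq 1
  have hω1 : ContDiff ℝ 1 (curl (u t)) := contDiff_curl (n := 1) (by exact_mod_cast hv2)
  have hωc : Continuous (curl (u t)) := continuous_curl hv1
  have hcωc : Continuous (curl (curl (u t))) := continuous_curl hω1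
  -- decay of the vorticity, of its derivative and of its curl
  have hω0 : ∀ x, ‖curl (u t) x‖ ≤ ‖curlCLM‖ * C * (1 + ‖x‖) ^ (-((5 : ℕ) : ℝ)) := fun x => by
    calc ‖curl (u t) x‖ ≤ ‖curlCLM‖ * ‖fderiv ℝ (u t) x‖ := norm_curl_le _ x
      _ ≤ ‖curlCLM‖ * (C * (1 + ‖x‖) ^ (-((5 : ℕ) : ℝ))) := by gcongr; exact h1 x
      _ = ‖curlCLM‖ * C * (1 + ‖x‖) ^ (-((5 : ℕ) : ℝ)) := by ring
  have hωD : ∀ x, ‖fderiv ℝ (curl (u t)) x‖ ≤ ‖curlCLM‖ * C * (1 + ‖x‖) ^ (-((5 : ℕ) : ℝ)) :=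
    fun x => by
    rw [fderiv_curl hv2 x]
    calc ‖curlCLM.comp (fderiv ℝ (fderiv ℝ (u t)) x)‖
        ≤ ‖curlCLM‖ * ‖fderiv ℝ (fderiv ℝ (u t)) x‖ := ContinuousLinearMap.opNorm_comp_le _ _
      _ ≤ ‖curlCLM‖ * (C * (1 + ‖x‖) ^ (-((5 : ℕ) : ℝ))) := by gcongr; exact h2 x
      _ = ‖curlCLM‖ * C * (1 + ‖x‖) ^ (-((5 : ℕ) : ℝ)) := by ring
  have hcω0 : ∀ x, ‖curl (curl (u t)) x‖ ≤
      ‖curlCLM‖ * (‖curlCLM‖ * C) * (1 + ‖x‖) ^ (-((5 : ℕ) : ℝ)) := fun x => by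
    calc ‖curl (curl (u t)) x‖ ≤ ‖curlCLM‖ * ‖fderiv ℝ (curl (u t)) x‖ := norm_curl_le _ x
      _ ≤ ‖curlCLM‖ * (‖curlCLM‖ * C * (1 + ‖x‖) ^ (-((5 : ℕ) : ℝ))) := by gcongr; exact hωD x
      _ = ‖curlCLM‖ * (‖curlCLM‖ * C) * (1 + ‖x‖) ^ (-((5 : ℕ) : ℝ)) := by ring
  have hcω0' : ∀ x, ‖curl (curl (u t)) x‖ ≤ ‖curlCLM‖ * (‖curlCLM‖ * C) := fun x => by
    calc ‖curl (curl (u t)) x‖ ≤ ‖curlCLM‖ * (‖curlCLM‖ * C) * (1 + ‖x‖) ^ (-((5 : ℕ) : ℝ)) :=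
          hcω0 x
      _ ≤ ‖curlCLM‖ * (‖curlCLM‖ * C) * 1 := by gcongr; exact hw1 x
      _ = ‖curlCLM‖ * (‖curlCLM‖ * C) := mul_one _
  have hωdiv : VectorCalculus.IsDivFree (curl (u t)) := fun x =>
    divergence_curl_eq_zero_holds (u t) hv2 x
  -- `Δu = -curl curl u` (incompressibility)
  have hΔ : ∀ x, (Δ (u t)) x = -curl (curl (u t)) x := fun x =>
    laplacian_eq_neg_curl_curl hv2 (h.divFree t ht) x
  -- the forced Navier–Stokes equation at time `t`: `∂ₜu = (νΔu − ∇p + f) − (u·∇)u`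
  have hE : ∀ x, timeDerivWithin S u t x =
      ν • (Δ (u t)) x - gradient (p t) x + f t x - convect (u t) (u t) x := fun x =>
    eq_sub_of_add_eq (h.momentum t ht x)
  -- the Lamb form and the Bernoulli function `q = ½|u|²`
  set q : EuclideanSpace ℝ (Fin 3) → ℝ := fun y => ‖u t y‖ ^ 2 / 2 with hq_def
  have hqd : ∀ x, HasFDerivAt q ((innerSL ℝ (u t x)).comp (fderiv ℝ (u t) x)) x := fun x =>
    hasFDerivAt_half_norm_sq (hv1.differentiable one_ne_zero x)
  have hq1' : ContDiff ℝ 1 q := by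
    have : ContDiff ℝ 1 fun y => ‖u t y‖ ^ 2 := hv1.norm_sq ℝ
    simpa [hq_def, div_eq_mul_inv] using this.mul contDiff_const
  have hLamb : ∀ x, convect (u t) (u t) x = cross (curl (u t) x) (u t x) + gradient q x :=
    fun x => convect_self_eq_cross_curl_add_gradient (hv1.differentiable one_ne_zero x)
  -- bounded gradients: `∇q` and `∇p = νΔu − (u·∇)u − ∂ₜu + f`
  have hqg : ∀ x, ‖gradient q x‖ ≤ C * C := fun x => by
    rw [gradient, LinearIsometryEquiv.norm_map, (hqd x).fderiv]
    calc ‖(innerSL ℝ (u t x)).comp (fderiv ℝ (u t) x)‖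
        ≤ ‖innerSL ℝ (u t x)‖ * ‖fderiv ℝ (u t) x‖ := ContinuousLinearMap.opNorm_comp_le _ _
      _ ≤ C * (1 + ‖x‖) ^ (-((5 : ℕ) : ℝ)) * (C * (1 + ‖x‖) ^ (-((5 : ℕ) : ℝ))) := by
          rw [innerSL_apply_norm]
          exact mul_le_mul (h0 x) (h1 x) (norm_nonneg _) (by positivity)
      _ ≤ C * 1 * (C * 1) := by gcongr <;> exact hw1 x
      _ = C * C := by ring
  have hconv : ∀ x, ‖convect (u t) (u t) x‖ ≤ C * C := fun x => by
    rw [convect_apply]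
    calc ‖fderiv ℝ (u t) x (u t x)‖ ≤ ‖fderiv ℝ (u t) x‖ * ‖u t x‖ :=
          ContinuousLinearMap.le_opNorm _ _
      _ ≤ C * (1 + ‖x‖) ^ (-((5 : ℕ) : ℝ)) * (C * (1 + ‖x‖) ^ (-((5 : ℕ) : ℝ))) :=
          mul_le_mul (h1 x) (h0 x) (norm_nonneg _) (by positivity)
      _ ≤ C * 1 * (C * 1) := by gcongr <;> exact hw1 x
      _ = C * C := by ring
  have hνΔ : ∀ x, ‖ν • (Δ (u t)) x‖ ≤ |ν| * (‖curlCLM‖ * (‖curlCLM‖ * C)) := fun x => by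
    rw [norm_smul, Real.norm_eq_abs, hΔ x, norm_neg]
    exact mul_le_mul_of_nonneg_left (hcω0' x) (abs_nonneg ν)
  have h3' : ∀ x, ‖timeDerivWithin S u t x‖ ≤ C := fun x =>
    (h3 x).trans (mul_le_of_le_one_right hC (hw1 x))
  have hpg : ∀ x, ‖gradient (p t) x‖ ≤
      |ν| * (‖curlCLM‖ * (‖curlCLM‖ * C)) + B + C * C + C := fun x => by
    have hpx : gradient (p t) x = ν • (Δ (u t)) x + f t x - convect (u t) (u t) x -
        timeDerivWithin S u t x := by
      rw [hE x]; abel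
    rw [hpx]
    exact norm_sub_le_of_le (norm_sub_le_of_le (norm_add_le_of_le (hνΔ x) (hfb x)) (hconv x))
      (h3' x)
  -- Lemma 1.5: both gradient pairings vanish
  have hIq : ∫ x, ⟪gradient q x, curl (u t) x⟫ = 0 :=
    integral_inner_gradient_eq_zero hω1 hq1' hωdiv hr hω0 hωD hqg
  have hIp : ∫ x, ⟪gradient (p t) x, curl (u t) x⟫ = 0 :=
    integral_inner_gradient_eq_zero hω1 hq1 hωdiv hr hω0 hωD hpg
  -- `⟪a × b, a⟫ = 0`
  have hcross : ∀ a b : EuclideanSpace ℝ (Fin 3), ⟪cross a b, a⟫ = 0 := fun a b => by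
    simp [cross, cross_apply, PiLp.inner_apply, Fin.sum_univ_three]
    ring
  -- pointwise: `⟪∂ₜu, ω⟫ = −ν⟪ω, curl ω⟫ − ⟪∇p, ω⟫ + ⟪f, ω⟫ − ⟪∇q, ω⟫`
  have hpt : ∀ x, ⟪timeDerivWithin S u t x, curl (u t) x⟫ =
      -(ν * ⟪curl (u t) x, curl (curl (u t)) x⟫) - ⟪gradient (p t) x, curl (u t) x⟫ +
        ⟪f t x, curl (u t) x⟫ - ⟪gradient q x, curl (u t) x⟫ := fun x => by
    rw [hE x, hΔ x, hLamb x, inner_sub_left, inner_add_left, inner_sub_left, real_inner_smul_left,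
      inner_add_left, hcross, zero_add, inner_neg_left,
      real_inner_comm (curl (u t) x) (curl (curl (u t)) x), mul_neg]
  -- integrability of the four pairings
  have hIS_int : Integrable fun x => ⟪curl (u t) x, curl (curl (u t)) x⟫ := by
    refine integrable_of_norm_le_decay_mul_decay (C₁ := ‖curlCLM‖ * C)
      (C₂ := ‖curlCLM‖ * (‖curlCLM‖ * C)) (r := ((5 : ℕ) : ℝ)) (r' := ((5 : ℕ) : ℝ))
      (hωc.inner hcωc) hr3 hK0 (by positivity) (by positivity) fun x => ?_
    exact (norm_inner_le_norm _ _).trans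
      (mul_le_mul (hω0 x) (hcω0 x) (norm_nonneg _) (by positivity))
  have hIq_int : Integrable fun x => ⟪gradient q x, curl (u t) x⟫ := by
    refine integrable_of_norm_le_const_mul_decay (C₁ := C * C) (C₂ := ‖curlCLM‖ * C)
      (r := ((5 : ℕ) : ℝ)) ((continuous_gradient_of_contDiff hq1').inner hωc) hr3 fun x => ?_
    exact (norm_inner_le_norm _ _).trans
      (mul_le_mul (hqg x) (hω0 x) (norm_nonneg _) (by positivity))
  have hIp_int : Integrable fun x => ⟪gradient (p t) x, curl (u t) x⟫ := by
    refine integrable_of_norm_le_const_mul_decay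
      (C₁ := |ν| * (‖curlCLM‖ * (‖curlCLM‖ * C)) + B + C * C + C) (C₂ := ‖curlCLM‖ * C)
      (r := ((5 : ℕ) : ℝ)) ((continuous_gradient_of_contDiff hq1).inner hωc) hr3 fun x => ?_
    exact (norm_inner_le_norm _ _).trans
      (mul_le_mul (hpg x) (hω0 x) (norm_nonneg _) (by positivity))
  have hIf_int : Integrable fun x => ⟪f t x, curl (u t) x⟫ := by
    refine integrable_of_norm_le_const_mul_decay (C₁ := B) (C₂ := ‖curlCLM‖ * C)
      (r := ((5 : ℕ) : ℝ)) (hfc.inner hωc) hr3 fun x => ?_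
    exact (norm_inner_le_norm _ _).trans
      (mul_le_mul (hfb x) (hω0 x) (norm_nonneg _) hB)
  have hI1 : Integrable fun x => -(ν * ⟪curl (u t) x, curl (curl (u t)) x⟫) :=
    (hIS_int.const_mul ν).neg
  have hI12 : Integrable fun x =>
      -(ν * ⟪curl (u t) x, curl (curl (u t)) x⟫) - ⟪gradient (p t) x, curl (u t) x⟫ :=
    hI1.sub hIp_int
  have hI123 : Integrable fun x =>
      -(ν * ⟪curl (u t) x, curl (curl (u t)) x⟫) - ⟪gradient (p t) x, curl (u t) x⟫ +
        ⟪f t x, curl (u t) x⟫ :=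
    hI12.add hIf_int
  simp_rw [hpt]
  rw [integral_sub hI123 hIq_int, integral_add hI12 hIf_int, integral_sub hI1 hIp_int, integral_neg,
    integral_const_mul, hIq, hIp, sub_zero, sub_zero, superhelicity]

/-- **The FORCED viscous helicity balance `dH/dt = −2ν S(u) + 2∫⟪f, ω⟫`** (Frisch 1995 (2.24)/(2.29)
with forcing; Moffatt 1969): for a classical Navier–Stokes solution with viscosity `ν` and force `f`
on `ℝ³ × S`, `S` **convex**, whose velocity decays rapidly uniformly in `t ∈ S`, and whose force
slices are continuous and bounded, the helicity `t ↦ ∫ ⟪u(t), curl u(t)⟫` has derivative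
`−2ν · superhelicity (u t) + 2 ∫ ⟪f(t), curl u(t)⟫` within `S` at every `t ∈ S`. Proof verbatim
along the tree's unforced `IsClassicalNSSolutionOn.hasDerivWithinAt_helicity` (differentiation under
the integral sign, `∂ₜ curl = curl ∂ₜ`, self-adjointness of the curl), then
`integral_inner_timeDerivWithin_curl_eq_forced`.
[cite: FrischTurbulence1995, §2.3 eqs. (2.24), (2.26)–(2.29)] [cite: Moffatt1969, §3 (helicity balance with forcing)] -/
theorem hasDerivWithinAt_helicity_forced
    (h : IsClassicalNSSolutionOn S ν f u p) (hS : Convex ℝ S)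
    (hu : HasUniformRapidDecayOn S u) {t : ℝ} (ht : t ∈ S)
    (hfc : ∀ s ∈ S, Continuous (f s)) {B : ℝ} (hfb : ∀ s ∈ S, ∀ x, ‖f s x‖ ≤ B) :
    HasDerivWithinAt (fun s => helicity (u s))
      (-(2 * ν * superhelicity (u t)) + 2 * ∫ x, ⟪f t x, curl (u t) x⟫) S t := by
  -- isolated points of `S`: the statement is empty
  by_cases hacc : AccPt t (𝓟 S)
  swap
  · exact hasDerivWithinAt_iff_hasFDerivWithinAt.2 (HasFDerivWithinAt.of_not_accPt hacc)
  have hU : UniqueDiffOn ℝ S := uniqueDiffOn_of_convex_of_accPt hS ht hacc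
  have hcl : S ⊆ closure (interior S) := subset_closure_interior_of_convex_of_accPt hS ht hacc
  have hsm := h.smooth_velocity
  -- decay exponent and constants (uniform in time)
  have hr3 : (Module.finrank ℝ (EuclideanSpace ℝ (Fin 3)) : ℝ) < ((5 : ℕ) : ℝ) := by
    rw [finrank_euclideanSpace_fin]; norm_num
  have hK0 : (0 : ℝ) ≤ ((5 : ℕ) : ℝ) := by norm_num
  obtain ⟨A0, hA0, hA0b⟩ := hu.norm_le_rpow 5
  obtain ⟨A1, hA1, hA1b⟩ := hu.norm_fderiv_le_rpow hsm hU 5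
  obtain ⟨A3, hA3, hA3b⟩ := hu.norm_timeDerivWithin_le_rpow hsm hU 5
  obtain ⟨A4, hA4, hA4b⟩ := hu.norm_fderiv_timeDerivWithin_le_rpow hsm hU 5
  set C : ℝ := A0 + A1 + A3 + A4 with hC_def
  have hC : 0 ≤ C := by rw [hC_def]; positivity
  have h0 : ∀ s ∈ S, ∀ x, ‖u s x‖ ≤ C * (1 + ‖x‖) ^ (-((5 : ℕ) : ℝ)) := fun s hs x =>
    le_decay_of_le_decay x (hA0b s hs x) (by rw [hC_def]; linarith)
  have h1 : ∀ s ∈ S, ∀ x, ‖fderiv ℝ (u s) x‖ ≤ C * (1 + ‖x‖) ^ (-((5 : ℕ) : ℝ)) := fun s hs x =>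
    le_decay_of_le_decay x (hA1b s hs x) (by rw [hC_def]; linarith)
  have h3 : ∀ s ∈ S, ∀ x,
      ‖timeDerivWithin S u s x‖ ≤ C * (1 + ‖x‖) ^ (-((5 : ℕ) : ℝ)) :=
    fun s hs x => le_decay_of_le_decay x (hA3b s hs x) (by rw [hC_def]; linarith)
  have h4 : ∀ s ∈ S, ∀ x,
      ‖fderiv ℝ (timeDerivWithin S u s) x‖ ≤ C * (1 + ‖x‖) ^ (-((5 : ℕ) : ℝ)) :=
    fun s hs x => le_decay_of_le_decay x (hA4b s hs x) (by rw [hC_def]; linarith)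
  have hw1 (x : EuclideanSpace ℝ (Fin 3)) : (1 + ‖x‖) ^ (-((5 : ℕ) : ℝ)) ≤ (1 : ℝ) :=
    rpow_neg_le_one x hK0
  -- curls: `‖curl (u s) x‖`, `‖curl (∂ₜu s) x‖`
  have hω0 : ∀ s ∈ S, ∀ x, ‖curl (u s) x‖ ≤ ‖curlCLM‖ * C * (1 + ‖x‖) ^ (-((5 : ℕ) : ℝ)) :=
    fun s hs x => by
    calc ‖curl (u s) x‖ ≤ ‖curlCLM‖ * ‖fderiv ℝ (u s) x‖ := norm_curl_le _ x
      _ ≤ ‖curlCLM‖ * (C * (1 + ‖x‖) ^ (-((5 : ℕ) : ℝ))) := by gcongr; exact h1 s hs x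
      _ = ‖curlCLM‖ * C * (1 + ‖x‖) ^ (-((5 : ℕ) : ℝ)) := by ring
  have hωt : ∀ s ∈ S, ∀ x, ‖curl (timeDerivWithin S u s) x‖ ≤
      ‖curlCLM‖ * C * (1 + ‖x‖) ^ (-((5 : ℕ) : ℝ)) := fun s hs x => by
    calc ‖curl (timeDerivWithin S u s) x‖
        ≤ ‖curlCLM‖ * ‖fderiv ℝ (timeDerivWithin S u s) x‖ := norm_curl_le _ x
      _ ≤ ‖curlCLM‖ * (C * (1 + ‖x‖) ^ (-((5 : ℕ) : ℝ))) := by gcongr; exact h4 s hs x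
      _ = ‖curlCLM‖ * C * (1 + ‖x‖) ^ (-((5 : ℕ) : ℝ)) := by ring
  -- regularity of the slices
  have hv1 : ∀ s ∈ S, ContDiff ℝ 1 (u s) := fun s hs =>
    contDiff_infty.1 (h.contDiff_velocity hs) 1
  have huc : ∀ s ∈ S, Continuous (u s) := fun s hs => hsm.continuous_slice hs
  have hsmt : IsSmoothSpaceTimeOn S (timeDerivWithin S u) := hsm.timeDerivWithin hU
  have ha1 : ∀ s ∈ S, ContDiff ℝ 1 (timeDerivWithin S u s) := fun s hs =>
    contDiff_infty.1 (hsmt.contDiff_slice hs) 1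
  have hac : ∀ s ∈ S, Continuous (timeDerivWithin S u s) := fun s hs =>
    hsmt.continuous_slice hs
  -- the vorticity as a jointly smooth field and its time derivative
  have hωst : IsSmoothSpaceTimeOn S (vorticity u) := (hsm.fderiv_slice hU).clm_comp curlCLM
  have hdω : ∀ s ∈ S, ∀ x, HasDerivWithinAt (fun s' => curl (u s') x)
      (curl (timeDerivWithin S u s) x) S s := fun s hs x => by
    rw [hsm.curl_timeDerivWithin hU hcl hs x]
    exact hωst.hasDerivWithinAt_timeDerivWithin hU hs x
  -- the dominating function
  set bound : EuclideanSpace ℝ (Fin 3) → ℝ := fun x =>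
    2 * (‖curlCLM‖ * C * C) * (1 + ‖x‖) ^ (-((5 : ℕ) : ℝ)) with hbound_def
  have hbound : Integrable bound := by
    have := (integrable_one_add_norm (E := EuclideanSpace ℝ (Fin 3)) (μ := volume)
      hr3).const_mul (2 * (‖curlCLM‖ * C * C))
    simpa [hbound_def] using this
  have hpair : ∀ x a b : EuclideanSpace ℝ (Fin 3), ‖a‖ ≤ C * (1 + ‖x‖) ^ (-((5 : ℕ) : ℝ)) →
      ‖b‖ ≤ ‖curlCLM‖ * C * (1 + ‖x‖) ^ (-((5 : ℕ) : ℝ)) →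
      ‖⟪a, b⟫‖ ≤ ‖curlCLM‖ * C * C * (1 + ‖x‖) ^ (-((5 : ℕ) : ℝ)) := by
    intro x a b ha hb
    calc ‖⟪a, b⟫‖ ≤ ‖a‖ * ‖b‖ := norm_inner_le_norm _ _
      _ ≤ C * (1 + ‖x‖) ^ (-((5 : ℕ) : ℝ)) * (‖curlCLM‖ * C * (1 + ‖x‖) ^ (-((5 : ℕ) : ℝ))) :=
          mul_le_mul ha hb (norm_nonneg _) (by positivity)
      _ ≤ C * 1 * (‖curlCLM‖ * C * (1 + ‖x‖) ^ (-((5 : ℕ) : ℝ))) := by gcongr; exact hw1 x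
      _ = ‖curlCLM‖ * C * C * (1 + ‖x‖) ^ (-((5 : ℕ) : ℝ)) := by ring
  have hF'le : ∀ s ∈ S, ∀ x, ‖⟪u s x, curl (timeDerivWithin S u s) x⟫ +
      ⟪timeDerivWithin S u s x, curl (u s) x⟫‖ ≤ bound x := by
    intro s hs x
    refine (norm_add_le _ _).trans ?_
    have e : bound x = ‖curlCLM‖ * C * C * (1 + ‖x‖) ^ (-((5 : ℕ) : ℝ)) +
        ‖curlCLM‖ * C * C * (1 + ‖x‖) ^ (-((5 : ℕ) : ℝ)) := by
      simp only [hbound_def]; ring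
    rw [e]
    exact add_le_add (hpair x _ _ (h0 s hs x) (hωt s hs x))
      (hpair x _ _ (h3 s hs x) (hω0 s hs x))
  have hFle : ∀ s ∈ S, ∀ x, ‖⟪u s x, curl (u s) x⟫‖ ≤ bound x := by
    intro s hs x
    refine (hpair x _ _ (h0 s hs x) (hω0 s hs x)).trans ?_
    simp only [hbound_def]
    have : 0 ≤ ‖curlCLM‖ * C * C * (1 + ‖x‖) ^ (-((5 : ℕ) : ℝ)) := by positivity
    linarith
  have hIe : Integrable fun x => ⟪u t x, curl (u t) x⟫ :=
    Integrable.mono' hbound ((huc t ht).inner (continuous_curl (hv1 t ht))).aestronglyMeasurable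
      (Eventually.of_forall (hFle t ht))
  -- (1) differentiate under the integral sign within `S`
  have hD : HasDerivWithinAt (fun s => ∫ x, ⟪u s x, curl (u s) x⟫)
      (∫ x, (⟪u t x, curl (timeDerivWithin S u t) x⟫ +
        ⟪timeDerivWithin S u t x, curl (u t) x⟫)) S t := by
    refine hasDerivWithinAt_integral_of_dominated_convex hS ht
      (F := fun s x => ⟪u s x, curl (u s) x⟫)
      (F' := fun s x => ⟪u s x, curl (timeDerivWithin S u s) x⟫ +
        ⟪timeDerivWithin S u s x, curl (u s) x⟫) (bound := bound) ?_ hIe hF'le hbound ?_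
    · exact fun s hs => ((huc s hs).inner (continuous_curl (hv1 s hs))).aestronglyMeasurable
    · intro s hs x
      exact (hsm.hasDerivWithinAt_timeDerivWithin hU hs x).inner ℝ (hdω s hs x)
  -- (2) the derivative is `2 ∫ ⟪∂ₜu, ω⟫ = -2ν S(u t) + 2 ∫ ⟪f, ω⟫`
  have hI1 : Integrable fun x => ⟪u t x, curl (timeDerivWithin S u t) x⟫ := by
    refine integrable_of_norm_le_rpow_neg ((huc t ht).inner (continuous_curl (ha1 t ht)))
      (C := ‖curlCLM‖ * C * C) hr3 fun x => ?_
    exact hpair x _ _ (h0 t ht x) (hωt t ht x)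
  have hI2 : Integrable fun x => ⟪timeDerivWithin S u t x, curl (u t) x⟫ := by
    refine integrable_of_norm_le_rpow_neg ((hac t ht).inner (continuous_curl (hv1 t ht)))
      (C := ‖curlCLM‖ * C * C) hr3 fun x => ?_
    exact hpair x _ _ (h3 t ht x) (hω0 t ht x)
  have hswap : ∫ x, ⟪u t x, curl (timeDerivWithin S u t) x⟫ =
      ∫ x, ⟪timeDerivWithin S u t x, curl (u t) x⟫ := by
    have := integral_inner_curl_eq_integral_inner_curl_of_decay (hv1 t ht) (ha1 t ht) hC
      (r := ((5 : ℕ) : ℝ)) (by norm_num) (h0 t ht) (h1 t ht) (h3 t ht) (h4 t ht)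
    rw [← this]
    exact integral_congr_ae (Eventually.of_forall fun x => real_inner_comm _ _)
  have hval : ∫ x, (⟪u t x, curl (timeDerivWithin S u t) x⟫ +
      ⟪timeDerivWithin S u t x, curl (u t) x⟫) =
        -(2 * ν * superhelicity (u t)) + 2 * ∫ x, ⟪f t x, curl (u t) x⟫ := by
    rw [integral_add hI1 hI2, hswap,
      integral_inner_timeDerivWithin_curl_eq_forced h hU hu ht (hfc t ht) (hfb t ht)]
    ring
  rw [hval] at hD
  exact hD

end PeriodMomentLaws

end Summit.NavierStokesRegularity.NavierStokesRegularity.Theorems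

end
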